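import Summits.QuantumFields.YangMills.Theorems.AllWindowsColdBoxBoxHighLineTiltThirdOrder
import Summits.QuantumFields.YangMills.Theorems.AllWindowsColdBoxBoxHighLineTiltCumulantBounds
import Summits.QuantumFields.YangMills.Theorems.AllWindowsColdBoxBoxHighLineTiltFourthMomentRecentre

/-!
# U5-L3b, generic layer: the FIFTH joint cumulant along the tilt by Cauchy–Schwarz, and its constant-centred form

Continuation of ✓`…TiltThirdOrder` (U5-L3a: `Tilt.tiltCum5`, `d/dt κ₄,t = κ₅,t`, `TiltThirdOrder`) for the recorded lift **L3** of planner
ym-idea-2 g18's `Cruxes/BoxWindowHighSU2213/U5-BLOCKERS.md` §2 («only `f‴ = κ₅,t` by Cauchy–Schwarz + NORM TRANSFER: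
`|κ₅| ≲ ‖c̃₀‖₄‖c̃_T‖₄‖Ũ‖₆³ ~ β⁻²(H²β^{−1/2})³ = H⁶β^{−7/2}`»), in the letters of ✓`…Step2Tilt` / ✓`…TiltNormTransfer` (LEAD sfw-p2 g77) /
✓`…TiltCumulantBounds` (w5 g22) / ✓`…TiltFourthMomentRecentre` (w4 g28).  For a finite measure `μ ≠ 0` and bounded measurable `U, G₁, G₂`:

* §1 two more Cauchy–Schwarz shapes in `L²(μ_t)`: `|E_t[G·W²]| ≤ √E_tG²·√E_tW⁴`, `|E_t[W³]| ≤ √E_tW²·√E_tW⁴`,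
  `|E_t[X·Y·W³]| ≤ √(√E_tX⁴·√E_tY⁴)·√E_tW⁶` (✓`abs_tiltExp_mul_le`, ✓`abs_tiltExp_mul_mul_le`);
* §2 ★ **`Tilt.abs_tiltCum5_le`** — `|κ₅,t(G₁,G₂,U,U,U)|` by the centred (at `t`) moments `E_t[G̃ᵢ²], E_t[G̃ᵢ⁴], E_t[Ũ²], E_t[Ũ⁴], E_t[Ũ⁶]`
  (five terms, each `~ β⁻²·(H²β^{−1/2})³` in the U5 sizes);
* §3 `Tilt.tiltExp_pow_six_le` (Jensen `(E_tX)⁶ ≤ E_tX⁶` from three Cauchy–Schwarz steps) and ★ **`Tilt.tiltExp_centred_pow_six_le`**: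
  `E_t[(G − E_tG)⁶] ≤ 64·E_t[(G − c)⁶]` for every constant `c` (companion of w4's ✓`tiltExp_centred_pow_four_le`, factor 16, and LEAD's
  ✓`tiltExp_centredSq_le`, factor 1);
* §4 ★★ **`Tilt.abs_tiltCum5_le_of_moments`** — `|κ₅,t|` by CONSTANT-CENTRED moment bounds `E_t[(Gᵢ−aᵢ)²] ≤ mᵢ`, `E_t[(Gᵢ−aᵢ)⁴] ≤ qᵢ`,
  `E_t[(U−b)^k] ≤ u_k` (`k = 2,4,6`): `≤ 32(q₁q₂)^{1/4}u₆^{1/2} + 28(m₁m₂u₂u₄)^{1/2} + 12u₂^{3/2}(q₁q₂)^{1/4}` (written with `Real.sqrt`s) —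
  the shape the norm-transfer step (✓`Tilt.tiltExp_le_of_nonneg`, `e^{2t·sup|U|}`) and the Gaussian sizes consume.

Tree + Mathlib; no definitions; standard axioms.
HONEST LABEL: abstract measure-theoretic support for the recorded lift L3 of the NEXT rung U5 (LINE-20 ⟨stmt-QuantumFields-24336⟩, unstaffed);
S5/U5, ⟨24004⟩ ⟨24335⟩ ⟨24336⟩ and route AllWindowsColdBox (DRAFT) remain OPEN; the Yang–Mills mass gap is NOT proved by this file; no summit is
proved by a line.  Seat ym-line-fcl-p3 g26.
-/

set_option autoImplicit false

noncomputable section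

open MeasureTheory Set
open Summit.QuantumFields.YangMills.Cruxes.NT.SkewResponse

namespace Summit.QuantumFields.YangMills.Theorems.AllWindowsColdBoxBoxHighLine

namespace Tilt

variable {Ω : Type*} [MeasurableSpace Ω] {μ : Measure Ω}

/-! ## §1 Two more Cauchy–Schwarz shapes -/

/-- `|E_t[G·W²]| ≤ √E_t[G²]·√E_t[W⁴]`. -/
theorem abs_tiltExp_mul_sq_le {G W : Ω → ℝ} {BG BW : ℝ} (hG : Measurable G) (hW : Measurable W)
    (hGb : ∀ x, |G x| ≤ BG) (hWb : ∀ x, |W x| ≤ BW) (U : Ω → ℝ) (t : ℝ) :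
    |tiltExp μ U t (fun x => G x * W x ^ 2)| ≤
      Real.sqrt (tiltExp μ U t (fun x => G x ^ 2)) * Real.sqrt (tiltExp μ U t (fun x => W x ^ 4)) := by
  have h := abs_tiltExp_mul_le (μ := μ) (W := fun x => W x ^ 2) hG (hW.pow_const 2) hGb (abs_pow_le_pow hWb 2) U t
  have e : (fun x => (W x ^ 2) ^ 2) = fun x => W x ^ 4 := by funext x; ring
  rw [e] at h
  exact h

/-- `|E_t[W³]| ≤ √E_t[W²]·√E_t[W⁴]`. -/
theorem abs_tiltExp_pow_three_le {W : Ω → ℝ} {BW : ℝ} (hW : Measurable W) (hWb : ∀ x, |W x| ≤ BW) (U : Ω → ℝ) (t : ℝ) :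
    |tiltExp μ U t (fun x => W x ^ 3)| ≤
      Real.sqrt (tiltExp μ U t (fun x => W x ^ 2)) * Real.sqrt (tiltExp μ U t (fun x => W x ^ 4)) := by
  have h := abs_tiltExp_mul_sq_le (μ := μ) hW hW hWb hWb U t
  have e : (fun x => W x * W x ^ 2) = fun x => W x ^ 3 := by funext x; ring
  rw [e] at h
  exact h

/-- `|E_t[X·Y·W³]| ≤ √(√E_t[X⁴]·√E_t[Y⁴])·√E_t[W⁶]` (the `L⁴·L⁴·L²` Hölder shape of ✓`abs_tiltExp_mul_mul_le` with `Z = W³`). -/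
theorem abs_tiltExp_mul_mul_pow_three_le {X Y W : Ω → ℝ} {BX BY BW : ℝ} (hX : Measurable X) (hY : Measurable Y)
    (hW : Measurable W) (hXb : ∀ x, |X x| ≤ BX) (hYb : ∀ x, |Y x| ≤ BY) (hWb : ∀ x, |W x| ≤ BW) (U : Ω → ℝ) (t : ℝ) :
    |tiltExp μ U t (fun x => X x * Y x * W x ^ 3)| ≤
      Real.sqrt (Real.sqrt (tiltExp μ U t (fun x => X x ^ 4)) * Real.sqrt (tiltExp μ U t (fun x => Y x ^ 4))) *
        Real.sqrt (tiltExp μ U t (fun x => W x ^ 6)) := by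
  have h := abs_tiltExp_mul_mul_le (μ := μ) (Z := fun x => W x ^ 3) hX hY (hW.pow_const 3) hXb hYb (abs_pow_le_pow hWb 3) U t
  have e : (fun x => (W x ^ 3) ^ 2) = fun x => W x ^ 6 := by funext x; ring
  rw [e] at h
  exact h

/-! ## §2 The fifth joint cumulant by Cauchy–Schwarz -/

/-- Triangle inequality for the five-term shape of `κ₅`. -/
theorem abs_five_term_le (a b c d e f g h i : ℝ) (hh : 0 ≤ h) :
    |a - b * c - 3 * (d * e) - 3 * (f * g) - 3 * (h * i)| ≤ |a| + |b| * |c| + 3 * (|d| * |e|) + 3 * (|f| * |g|) + 3 * (h * |i|) := by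
  have h1 : |a - b * c - 3 * (d * e) - 3 * (f * g) - 3 * (h * i)| ≤
      |a| + |b * c| + |3 * (d * e)| + |3 * (f * g)| + |3 * (h * i)| := by
    have := abs_sub (a - b * c - 3 * (d * e) - 3 * (f * g)) (3 * (h * i))
    have := abs_sub (a - b * c - 3 * (d * e)) (3 * (f * g))
    have := abs_sub (a - b * c) (3 * (d * e))
    have := abs_sub a (b * c)
    linarith
  have e3 : |(3 : ℝ)| = 3 := abs_of_pos (by norm_num)
  rw [abs_mul b c, abs_mul, abs_mul d e, abs_mul, abs_mul f g, abs_mul, abs_mul h i, e3, abs_of_nonneg hh] at h1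
  exact h1

/-- ★ **BOUND ON THE FIFTH JOINT CUMULANT ALONG THE TILT** (Cauchy–Schwarz / `L⁴·L⁴·L²` Hölder in `L²(μ_t)`): with `X̃ = X − E_tX`,
`|κ₅,t(G₁,G₂,U,U,U)| ≤ √(√E_t[G̃₁⁴]·√E_t[G̃₂⁴])·√E_t[Ũ⁶] + √E_t[G̃₁²]·√E_t[G̃₂²]·(√E_t[Ũ²]·√E_t[Ũ⁴])`
`+ 3·(√E_t[G̃₁²]·√E_t[Ũ²])·(√E_t[G̃₂²]·√E_t[Ũ⁴]) + 3·(√E_t[G̃₂²]·√E_t[Ũ²])·(√E_t[G̃₁²]·√E_t[Ũ⁴]) + 3·E_t[Ũ²]·(√(√E_t[G̃₁⁴]·√E_t[G̃₂⁴])·√E_t[Ũ²])`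
— in the U5-L3 sizes (`‖G̃ᵢ‖₂,₄ ~ β⁻¹`, `‖Ũ‖₂,₄,₆ ~ H²β^{−1/2}·polylog`) every term is `~ β⁻²·(H²β^{−1/2})³ = H⁶β^{−7/2}`. -/
theorem abs_tiltCum5_le [IsFiniteMeasure μ] [NeZero μ] {U G₁ G₂ : Ω → ℝ} {BU B₁ B₂ : ℝ} (hU : Measurable U)
    (h₁ : Measurable G₁) (h₂ : Measurable G₂) (hUb : ∀ x, |U x| ≤ BU) (h₁b : ∀ x, |G₁ x| ≤ B₁) (h₂b : ∀ x, |G₂ x| ≤ B₂) (t : ℝ) :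
    |tiltCum5 μ U t G₁ G₂| ≤
      Real.sqrt (Real.sqrt (tiltExp μ U t (fun x => (G₁ x - tiltExp μ U t G₁) ^ 4)) *
            Real.sqrt (tiltExp μ U t (fun x => (G₂ x - tiltExp μ U t G₂) ^ 4))) *
          Real.sqrt (tiltExp μ U t (fun x => (U x - tiltExp μ U t U) ^ 6)) +
        Real.sqrt (tiltExp μ U t (fun x => (G₁ x - tiltExp μ U t G₁) ^ 2)) *
            Real.sqrt (tiltExp μ U t (fun x => (G₂ x - tiltExp μ U t G₂) ^ 2)) *
          (Real.sqrt (tiltExp μ U t (fun x => (U x - tiltExp μ U t U) ^ 2)) *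
            Real.sqrt (tiltExp μ U t (fun x => (U x - tiltExp μ U t U) ^ 4))) +
        3 * (Real.sqrt (tiltExp μ U t (fun x => (G₁ x - tiltExp μ U t G₁) ^ 2)) *
              Real.sqrt (tiltExp μ U t (fun x => (U x - tiltExp μ U t U) ^ 2)) *
            (Real.sqrt (tiltExp μ U t (fun x => (G₂ x - tiltExp μ U t G₂) ^ 2)) *
              Real.sqrt (tiltExp μ U t (fun x => (U x - tiltExp μ U t U) ^ 4)))) +
        3 * (Real.sqrt (tiltExp μ U t (fun x => (G₂ x - tiltExp μ U t G₂) ^ 2)) *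
              Real.sqrt (tiltExp μ U t (fun x => (U x - tiltExp μ U t U) ^ 2)) *
            (Real.sqrt (tiltExp μ U t (fun x => (G₁ x - tiltExp μ U t G₁) ^ 2)) *
              Real.sqrt (tiltExp μ U t (fun x => (U x - tiltExp μ U t U) ^ 4)))) +
        3 * (tiltExp μ U t (fun x => (U x - tiltExp μ U t U) ^ 2) *
            (Real.sqrt (Real.sqrt (tiltExp μ U t (fun x => (G₁ x - tiltExp μ U t G₁) ^ 4)) *
                Real.sqrt (tiltExp μ U t (fun x => (G₂ x - tiltExp μ U t G₂) ^ 4))) *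
              Real.sqrt (tiltExp μ U t (fun x => (U x - tiltExp μ U t U) ^ 2)))) := by
  set m₁ := tiltExp μ U t G₁
  set m₂ := tiltExp μ U t G₂
  set mU := tiltExp μ U t U
  -- the centred observables are bounded measurable
  have hc₁ : Measurable fun x => G₁ x - m₁ := h₁.sub measurable_const
  have hc₂ : Measurable fun x => G₂ x - m₂ := h₂.sub measurable_const
  have hcU : Measurable fun x => U x - mU := hU.sub measurable_const
  have hc₁b : ∀ x, |G₁ x - m₁| ≤ B₁ + |m₁| := fun x => (abs_sub _ _).trans (add_le_add (h₁b x) le_rfl)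
  have hc₂b : ∀ x, |G₂ x - m₂| ≤ B₂ + |m₂| := fun x => (abs_sub _ _).trans (add_le_add (h₂b x) le_rfl)
  have hcUb : ∀ x, |U x - mU| ≤ BU + |mU| := fun x => (abs_sub _ _).trans (add_le_add (hUb x) le_rfl)
  -- the Cauchy–Schwarz estimates of the eight raw factors
  have hA := abs_tiltExp_mul_mul_pow_three_le (μ := μ) hc₁ hc₂ hcU hc₁b hc₂b hcUb U t
  have hB := abs_tiltExp_mul_le (μ := μ) hc₁ hc₂ hc₁b hc₂b U t
  have hC := abs_tiltExp_pow_three_le (μ := μ) hcU hcUb U t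
  have hD₁ := abs_tiltExp_mul_le (μ := μ) hc₁ hcU hc₁b hcUb U t
  have hD₂ := abs_tiltExp_mul_le (μ := μ) hc₂ hcU hc₂b hcUb U t
  have hE₁ := abs_tiltExp_mul_sq_le (μ := μ) hc₁ hcU hc₁b hcUb U t
  have hE₂ := abs_tiltExp_mul_sq_le (μ := μ) hc₂ hcU hc₂b hcUb U t
  have hF := abs_tiltExp_mul_mul_le (μ := μ) hc₁ hc₂ hcU hc₁b hc₂b hcUb U t
  have hU2 : 0 ≤ tiltExp μ U t (fun x => (U x - mU) ^ 2) := by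
    haveI := isProbabilityMeasure_tilted_mul (μ := μ) hU hUb t
    rw [tiltExp_eq_integral_tilted]; exact integral_nonneg fun x => sq_nonneg _
  unfold tiltCum5
  refine (abs_five_term_le _ _ _ _ _ _ _ _ _ hU2).trans ?_
  have s1 := Real.sqrt_nonneg (tiltExp μ U t (fun x => (G₁ x - m₁) ^ 2))
  have s2 := Real.sqrt_nonneg (tiltExp μ U t (fun x => (G₂ x - m₂) ^ 2))
  have sU := Real.sqrt_nonneg (tiltExp μ U t (fun x => (U x - mU) ^ 2))
  have t2 := mul_le_mul hB hC (abs_nonneg _) (mul_nonneg s1 s2)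
  have t3 := mul_le_mul hD₁ hE₂ (abs_nonneg _) (mul_nonneg s1 sU)
  have t4 := mul_le_mul hD₂ hE₁ (abs_nonneg _) (mul_nonneg s2 sU)
  have t5 := mul_le_mul_of_nonneg_left hF hU2
  linarith [hA, t2, t3, t4, t5]

/-! ## §3 Jensen for the sixth power and re-centring of the sixth moment at the tilted mean -/

/-- **Jensen for the sixth power** along the tilt: `(E_tX)⁶ ≤ E_t[X⁶]` (from `(E_tX)² ≤ E_tX²`, `(E_tX²)² ≤ E_tX⁴` and
`(E_tX⁴)² = (E_t[X·X³])² ≤ E_tX²·E_tX⁶` — Cauchy–Schwarz only). -/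
theorem tiltExp_pow_six_le [IsFiniteMeasure μ] [NeZero μ] {U X : Ω → ℝ} {BU BX : ℝ} (hU : Measurable U) (hX : Measurable X)
    (hUb : ∀ x, |U x| ≤ BU) (hXb : ∀ x, |X x| ≤ BX) (t : ℝ) :
    tiltExp μ U t X ^ 6 ≤ tiltExp μ U t (fun x => X x ^ 6) := by
  haveI := isProbabilityMeasure_tilted_mul (μ := μ) hU hUb t
  have hX2 : Measurable fun x => X x ^ 2 := hX.pow_const 2
  have hX2b : ∀ x, |X x ^ 2| ≤ BX ^ 2 := abs_pow_le_pow hXb 2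
  have j1 : tiltExp μ U t X ^ 2 ≤ tiltExp μ U t (fun x => X x ^ 2) := tiltExp_sq_le (μ := μ) hU hX hUb hXb t
  have j2 : tiltExp μ U t (fun x => X x ^ 2) ^ 2 ≤ tiltExp μ U t (fun x => X x ^ 4) := by
    have h := tiltExp_sq_le (μ := μ) hU hX2 hUb hX2b t
    have e : (fun x => (X x ^ 2) ^ 2) = fun x => X x ^ 4 := by funext x; ring
    rwa [e] at h
  have j3 : tiltExp μ U t (fun x => X x ^ 4) ^ 2 ≤ tiltExp μ U t (fun x => X x ^ 2) * tiltExp μ U t (fun x => X x ^ 6) := by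
    have h := abs_tiltExp_mul_le (μ := μ) (W := fun x => X x ^ 3) hX (hX.pow_const 3) hXb (abs_pow_le_pow hXb 3) U t
    have e1 : (fun x => X x * X x ^ 3) = fun x => X x ^ 4 := by funext x; ring
    have e2 : (fun x => (X x ^ 3) ^ 2) = fun x => X x ^ 6 := by funext x; ring
    rw [e1, e2] at h
    have hA : 0 ≤ tiltExp μ U t (fun x => X x ^ 2) := by
      rw [tiltExp_eq_integral_tilted]; exact integral_nonneg fun x => sq_nonneg _
    have hC : 0 ≤ tiltExp μ U t (fun x => X x ^ 6) := by
      rw [tiltExp_eq_integral_tilted]; exact integral_nonneg fun x => by positivity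
    have h' := pow_le_pow_left₀ (abs_nonneg _) h 2
    rw [sq_abs, mul_pow, Real.sq_sqrt hA, Real.sq_sqrt hC] at h'
    exact h'
  have hA : 0 ≤ tiltExp μ U t (fun x => X x ^ 2) := by
    rw [tiltExp_eq_integral_tilted]; exact integral_nonneg fun x => sq_nonneg _
  have hC : 0 ≤ tiltExp μ U t (fun x => X x ^ 6) := by
    rw [tiltExp_eq_integral_tilted]; exact integral_nonneg fun x => by positivity
  -- `A⁴ ≤ B² ≤ A·C`, hence `A³ ≤ C`
  set A := tiltExp μ U t (fun x => X x ^ 2)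
  set B := tiltExp μ U t (fun x => X x ^ 4)
  set C := tiltExp μ U t (fun x => X x ^ 6)
  have hB : 0 ≤ B := (sq_nonneg _).trans j2
  have h4 : A ^ 4 ≤ A * C := by
    calc A ^ 4 = (A ^ 2) ^ 2 := by ring
      _ ≤ B ^ 2 := pow_le_pow_left₀ (sq_nonneg _) j2 2
      _ ≤ A * C := j3
  have h3 : A ^ 3 ≤ C := by
    rcases hA.lt_or_eq with hpos | hzero
    · have : A * A ^ 3 ≤ A * C := by calc A * A ^ 3 = A ^ 4 := by ring
        _ ≤ A * C := h4
      exact le_of_mul_le_mul_left this hpos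
    · rw [← hzero]; simpa using hC
  calc tiltExp μ U t X ^ 6 = (tiltExp μ U t X ^ 2) ^ 3 := by ring
    _ ≤ A ^ 3 := pow_le_pow_left₀ (sq_nonneg _) j1 3
    _ ≤ C := h3

/-- ★ **Sixth moment re-centred at the tilted mean**: `E_t[(G − E_tG)⁶] ≤ 64·E_t[(G − c)⁶]` for every constant `c`
(pointwise `(x − δ)⁶ ≤ 32(x⁶ + δ⁶)` with `δ = E_t[G − c]`, then Jensen `δ⁶ ≤ E_t[(G − c)⁶]`; companion of w4 g28's
✓`tiltExp_centred_pow_four_le`). -/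
theorem tiltExp_centred_pow_six_le [IsFiniteMeasure μ] [NeZero μ] {U G : Ω → ℝ} {BU BG : ℝ} (hU : Measurable U) (hG : Measurable G)
    (hUb : ∀ x, |U x| ≤ BU) (hGb : ∀ x, |G x| ≤ BG) (t c : ℝ) :
    tiltExp μ U t (fun x => (G x - tiltExp μ U t G) ^ 6) ≤ 64 * tiltExp μ U t (fun x => (G x - c) ^ 6) := by
  set m := tiltExp μ U t G with hm
  set δ := m - c with hδ
  have hGc : Measurable fun x => G x - c := hG.sub measurable_const
  have hGcb : ∀ x, |G x - c| ≤ BG + |c| := fun x => (abs_sub _ _).trans (add_le_add (hGb x) le_rfl)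
  have hGc6 : Measurable fun x => (G x - c) ^ 6 := hGc.pow_const 6
  have hGc6b : ∀ x, |(G x - c) ^ 6| ≤ (BG + |c|) ^ 6 := abs_pow_le_pow hGcb 6
  have hGm6 : Measurable fun x => (G x - m) ^ 6 := (hG.sub measurable_const).pow_const 6
  have hGm6b : ∀ x, |(G x - m) ^ 6| ≤ (BG + |m|) ^ 6 :=
    abs_pow_le_pow (fun x => (abs_sub _ _).trans (add_le_add (hGb x) le_rfl)) 6
  have hR1 : Measurable fun x => 32 * (G x - c) ^ 6 := hGc6.const_mul 32
  have hR1b : ∀ x, |32 * (G x - c) ^ 6| ≤ 32 * (BG + |c|) ^ 6 := fun x => by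
    rw [abs_mul, abs_of_pos (by norm_num : (0 : ℝ) < 32)]; exact mul_le_mul_of_nonneg_left (hGc6b x) (by norm_num)
  have hR : Measurable fun x => 32 * (G x - c) ^ 6 + 32 * δ ^ 6 := hR1.add measurable_const
  have hRb : ∀ x, |32 * (G x - c) ^ 6 + 32 * δ ^ 6| ≤ 32 * (BG + |c|) ^ 6 + 32 * δ ^ 6 := fun x =>
    (abs_add_le _ _).trans (add_le_add (hR1b x) (le_of_eq (abs_of_nonneg (by positivity))))
  -- pointwise `(x − δ)⁶ ≤ 32(x⁶ + δ⁶)`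
  have hpt : ∀ x, (G x - m) ^ 6 ≤ 32 * (G x - c) ^ 6 + 32 * δ ^ 6 := by
    intro x
    have h := (show Even 6 by decide).add_pow_le (a := G x - c) (b := -δ)
    have e1 : G x - c + -δ = G x - m := by rw [hδ]; ring
    have e2 : (-δ) ^ 6 = δ ^ 6 := by ring
    rw [e1, e2] at h
    norm_num at h
    linarith
  have h1 := tiltExp_mono (μ := μ) hGm6 hR hGm6b hRb U t hpt
  rw [tiltExp_add (μ := μ) hR1 measurable_const hR1b (fun _ => le_of_eq (abs_of_nonneg (by positivity))) U t,
    tiltExp_const_mul, tiltExp_const hU hUb] at h1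
  -- Jensen: `δ⁶ ≤ E_t[(G − c)⁶]`
  have hδE : δ = tiltExp μ U t (fun x => G x - c) := by rw [tiltExp_sub_const hU hG hUb hGb]
  have j := tiltExp_pow_six_le (μ := μ) hU hGc hUb hGcb t
  rw [← hδE] at j
  linarith

/-! ## §4 The fifth cumulant from constant-centred moments -/

/-- ★★ **`κ₅,t` from CONSTANT-CENTRED moments**: if `E_t[(Gᵢ−aᵢ)²] ≤ mᵢ`, `E_t[(Gᵢ−aᵢ)⁴] ≤ qᵢ` (`i = 1,2`) and `E_t[(U−b)²] ≤ u₂`,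
`E_t[(U−b)⁴] ≤ u₄`, `E_t[(U−b)⁶] ≤ u₆`, then (✓variance minimality, ✓`tiltExp_centred_pow_four_le` (factor 16), `tiltExp_centred_pow_six_le`
(factor 64) substituted monotonically into `abs_tiltCum5_le`)
`|κ₅,t| ≤ √(√(16q₁)·√(16q₂))·√(64u₆) + √m₁√m₂·(√u₂·√(16u₄)) + 3(√m₁√u₂)(√m₂√(16u₄)) + 3(√m₂√u₂)(√m₁√(16u₄)) + 3u₂·(√(√(16q₁)√(16q₂))·√u₂)`
(numerically `= 32(q₁q₂)^{1/4}u₆^{1/2} + 28(m₁m₂u₂u₄)^{1/2} + 12u₂^{3/2}(q₁q₂)^{1/4}`). -/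
theorem abs_tiltCum5_le_of_moments [IsFiniteMeasure μ] [NeZero μ] {U G₁ G₂ : Ω → ℝ} {BU B₁ B₂ : ℝ} (hU : Measurable U)
    (h₁ : Measurable G₁) (h₂ : Measurable G₂) (hUb : ∀ x, |U x| ≤ BU) (h₁b : ∀ x, |G₁ x| ≤ B₁) (h₂b : ∀ x, |G₂ x| ≤ B₂)
    (t a₁ a₂ b : ℝ) {m₁ m₂ q₁ q₂ u₂ u₄ u₆ : ℝ}
    (hm₁ : tiltExp μ U t (fun x => (G₁ x - a₁) ^ 2) ≤ m₁) (hm₂ : tiltExp μ U t (fun x => (G₂ x - a₂) ^ 2) ≤ m₂)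
    (hq₁ : tiltExp μ U t (fun x => (G₁ x - a₁) ^ 4) ≤ q₁) (hq₂ : tiltExp μ U t (fun x => (G₂ x - a₂) ^ 4) ≤ q₂)
    (hu₂ : tiltExp μ U t (fun x => (U x - b) ^ 2) ≤ u₂) (hu₄ : tiltExp μ U t (fun x => (U x - b) ^ 4) ≤ u₄)
    (hu₆ : tiltExp μ U t (fun x => (U x - b) ^ 6) ≤ u₆) :
    |tiltCum5 μ U t G₁ G₂| ≤
      Real.sqrt (Real.sqrt (16 * q₁) * Real.sqrt (16 * q₂)) * Real.sqrt (64 * u₆) +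
        Real.sqrt m₁ * Real.sqrt m₂ * (Real.sqrt u₂ * Real.sqrt (16 * u₄)) +
        3 * (Real.sqrt m₁ * Real.sqrt u₂ * (Real.sqrt m₂ * Real.sqrt (16 * u₄))) +
        3 * (Real.sqrt m₂ * Real.sqrt u₂ * (Real.sqrt m₁ * Real.sqrt (16 * u₄))) +
        3 * (u₂ * (Real.sqrt (Real.sqrt (16 * q₁) * Real.sqrt (16 * q₂)) * Real.sqrt u₂)) := by
  have h := abs_tiltCum5_le (μ := μ) hU h₁ h₂ hUb h₁b h₂b t
  have c2₁ := (tiltExp_centredSq_le (μ := μ) hU h₁ hUb h₁b t a₁).trans hm₁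
  have c2₂ := (tiltExp_centredSq_le (μ := μ) hU h₂ hUb h₂b t a₂).trans hm₂
  have c2U := (tiltExp_centredSq_le (μ := μ) hU hU hUb hUb t b).trans hu₂
  have c4₁ : tiltExp μ U t (fun x => (G₁ x - tiltExp μ U t G₁) ^ 4) ≤ 16 * q₁ :=
    (tiltExp_centred_pow_four_le (μ := μ) hU h₁ hUb h₁b t a₁).trans (by linarith)
  have c4₂ : tiltExp μ U t (fun x => (G₂ x - tiltExp μ U t G₂) ^ 4) ≤ 16 * q₂ :=
    (tiltExp_centred_pow_four_le (μ := μ) hU h₂ hUb h₂b t a₂).trans (by linarith)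
  have c4U : tiltExp μ U t (fun x => (U x - tiltExp μ U t U) ^ 4) ≤ 16 * u₄ :=
    (tiltExp_centred_pow_four_le (μ := μ) hU hU hUb hUb t b).trans (by linarith)
  have c6U : tiltExp μ U t (fun x => (U x - tiltExp μ U t U) ^ 6) ≤ 64 * u₆ :=
    (tiltExp_centred_pow_six_le (μ := μ) hU hU hUb hUb t b).trans (by linarith)
  have hU2 : 0 ≤ tiltExp μ U t (fun x => (U x - tiltExp μ U t U) ^ 2) := by
    haveI := isProbabilityMeasure_tilted_mul (μ := μ) hU hUb t
    rw [tiltExp_eq_integral_tilted]; exact integral_nonneg fun x => sq_nonneg _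
  have hu₂0 : 0 ≤ u₂ := hU2.trans c2U
  refine h.trans ?_
  gcongr

end Tilt

end Summit.QuantumFields.YangMills.Theorems.AllWindowsColdBoxBoxHighLine

end
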